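import Summits.QuantumFields.YangMills.Theorems.UnitScaleTiltProp7Size19OfRows
import Summits.QuantumFields.YangMills.Theorems.UnitScaleTiltProp7StubEXOfChartPiecesTwS3SE
import HarnessLib

/-!
# [LIFT-THREAD 2 TWIN «D21» (EX namer ★w2-19200 g9 2026-08-29T17:22:48Z PEN ASSIGNMENT v1; px12 g11 SED LIST v0 2bd9ff01 row D21; ★★OWNER RULING №30; seat ym-routeR-w6 g11):
# ✓`Prop7Size19OfRowsFamilyL` (px14 g3, LIFT-THREAD 1 twin Size19ᴸ) BYTE-IDENTICAL except (a) the namespace (suffix `Lift`), (b) the token `Lift L i U₀ →` (the door's EXISTING opaque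
# predicate binder `Lift`) inserted immediately after the last regularity guard of EVERY op-shaped N06-derived row — after `ρ ≤ α L →` in `norm_G prop4 norm_H₁`, after
# `RegPr … (α L) U₀ →` in `h46₀ h46₁ h46₂` (uniform face: all 13 print rows carry the antecedent of record, hence every row derived from them does) — the at-record row `hΔsol`
# (= D18's conclusion) and the CONCLUSION are UNCHANGED (they carry `Lift L i U₀ →` since LIFT-THREAD 1), (c) proof = v1's with `hLift` (already intro'd) passed at the six row
# applications.  WHY (LOCATE d8153c1b, px12 g11): `hPcol` (and likely `h349` + the kernel rows) is not inhabitable on stratum (c) for every `U₀ ∈ RegPr`; print proves the rows at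
# backgrounds admitting the parallel lift, which the junction supplies by ✓`Prop7IrrLiftRowOfRecord.hIrrLift_of_record`; the S-files instantiate `Lift :=` the 6-line clause of record.]

# [LIFT-THREAD TWIN «Size19ᴸ» (EX namer ★w2-19200 g7 2026-08-29T01:05:18Z (ii), seat ym3-torus-px14 g3): ✓`Prop7Size19OfRowsFamily` BYTE-IDENTICAL except (a) one new OPAQUE binder
# `Lift : ∀ L (i : Idx L), GaugeField … → Prop`, (b) ONE inserted antecedent `Lift L i U₀ →` right after `CloseAvg … V U₀ →` in the ROW `hΔsol` AND in the CONCLUSION (`hSize19′`[Lift] = T6ᴸ's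
# `hSize19` binder), (c) proof = one extra `intro hLift` + pass-through to `hΔsol` (twice).]

# Route `UnitScaleTilt`, crux «MinimiserStabilityRegPr» (stmt-QuantumFields-19200, stub EX `stub_existenceMinimalOrbit`), route (α) — **JUNCTION-SIZE19 AT THE FAMILY LEVEL:
# THE DISPLAYED ROW `hSize19′` OF THE EX KNIT OF RECORD v3.4ˢ″ (✓`Prop7StubEXOfChartPiecesTwS7`, ★★OWNER RULING g27-№10 (2)) VERBATIM, FROM THREE PRINT-SHAPED ROW FAMILIES**
# — (46)₁ `h46₁` and (46)₂ = (137)–(140) `h46₂` for the NAMED letter `Hf` (landed at `H46`: ✓p649358, ✓p652273∕✓p656472), and (136)+(140) `hΔsol` for the (115)-piece of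
# the solution of (111) (print's ε₁-form) — plus one L-only constant window `hMdoor` (the junction's explicit member constant read at `ρ ≤ α`, with `C₂ˢ·η² =
# 40·(2·(3·(2e + 2700Lα)))∕e²`, is below the display's `M L`).  Everything else is the knit's own windows (`hq47 hR6 hrε2 hrα hr4 hr16 hWe hWε`) and letter rows
# (`norm_G prop4 norm_H₁ h46₀`; the (45)∕(21)ˢ∕reality rows of `Hf` are not read here), discharged by name: ✓`Prop7Size19OfRows.size19_of_rows` (p655784) at each member, ✓`inputs_CmapTwS` for the chart (47), ✓`windows_of_W`∕
# ✓`windows_of_admissible` for the admissibility numerics.  With this door a successor display S8 := S7 with `hSize19′ ↦ {h46₁, h46₂, hΔsol, hMdoor}` is a by-name composition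
# (display changes only on the ★★OWNER's word; this file changes nothing of record).
#
# Cell `ym3-torus`, width seat `ym-ust-19200-w2` (gen 5; EX knit lineage ∕ EX letter namer).  THEOREMS ONLY (0 `def`, 0 `sorry`); `--supports stmt-QuantumFields-19200 --as helper`,
# count-neutral.  YM₃ on T³ is a ladder rung (R3), not the Clay problem; nothing here claims the stub, the crux, d = 4 or the mass gap.
#
# INHABITABILITY (★★OWNER RULING g27-№9 (3)): `h46₁`∕`h46₂` — at `Hf := H46 … U₀` they are ✓`Prop7H46GradRow` ∕ ✓`hΔH_of_rows'` (modulo those files' displayed N06 rows);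
# `hΔsol` — print (128)–(136) + (140) for THE solution (★px16 g0's ✓`…HDsolOfRowsT3` + «hΔsol CLOSED» reduce it to the T³ identity (133) in the (111)-letters, the open piece);
# `hMdoor` — a choice of the display constant `M L` (L-only: `B₀ BH BH₂ MΔ ef α`), satisfiable by definition.
#
# References: T. Bałaban, CMP 102 (1985) 277–309 [Balaban1985Variational] ((19) p.281, (46)–(47) p.285, (55) p.286, (111) p.294, Prop. 6 p.295, (ii) + (123)–(140)
# pp.296–299); CMP 99 (1985) 389–434 [Balaban1985BackgroundPropagators] (Thm 3.12 p.421).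
-/

noncomputable section

open scoped BigOperators Matrix.Norms.L2Operator Matrix

namespace Summit.QuantumFields.YangMills.Theorems.Prop7Size19OfRowsFamilyLLift

open Literature.MathematicalPhysics.QuantumFieldTheory.Balaban1983to89
open Literature.MathematicalPhysics.QuantumFieldTheory.Balaban1983to89.T3ContinuumYM3Torus
open Literature.MathematicalPhysics.QuantumFieldTheory.Balaban1983to89.T3UnitLawDensityEML (ℰp)
open Literature.MathematicalPhysics.QuantumFieldTheory.Balaban1983to89.T3TiltDescent (descendTo)
open Literature.MathematicalPhysics.QuantumFieldTheory.Balaban1983to89.T3ConstrainedMinimiser (fibre)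
open Literature.MathematicalPhysics.QuantumFieldTheory.Balaban1983to89.T3PrintedRegularMinimiser (RegPr)
open Literature.MathematicalPhysics.QuantumFieldTheory.Balaban1983to89.T3PrintedMinimiserExistence (regPr_mono)
open Literature.MathematicalPhysics.QuantumFieldTheory.Balaban1983to89.T3Thm1Carrier
open Literature.MathematicalPhysics.QuantumFieldTheory.Balaban1983to89.T3SectALandauChart (In19 emb15 CloseAvg eta)
open B9SectCLatticeCarrier (Bond)
open B11Eq115Space (NegSup NegSize Space115 JetSup)
open B11Eq111FrakG (nabla115)
open B11Eq98CurrentSlot (Jcur)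
open B11Prop3Model (Dfix)
open B13Contraction113 (QuadAnalytic)
open MatrixLog (mlog)
open Summit.QuantumFields.YangMills.Theorems.Prop7TPrint (nMax19 expHermField)
open Summit.QuantumFields.YangMills.Theorems.Prop7SPrint (NormS IsLandauPrintS)
open Summit.QuantumFields.YangMills.Theorems.Prop7SectET3Transport (periodsT3 bgOfCfg bondEquiv)
open Summit.QuantumFields.YangMills.Theorems.Prop7SymAvgTwSym (QTwS CmapTwS Chart47T3twS)
open Summit.QuantumFields.YangMills.Theorems.Prop7SymAvgGL (QSym)
open Summit.QuantumFields.YangMills.Theorems.Prop7Bound20SymLog (bound20_symLog_of_closeAvg)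
open Summit.QuantumFields.YangMills.Theorems.Prop7StubEXOfChartPiecesTwL (windows_of_admissible three_le_memberL)
open Summit.QuantumFields.YangMills.Theorems.Prop7StubEXOfChartPiecesTwS (windows_of_W)
open T3SectALandauChart (bgUnits covGradT covCodiffCurlT covLapFormT)
open Summit.QuantumFields.YangMills.Theorems.Prop7CmapTwSymInputs (inputs_CmapTwS)
open Summit.QuantumFields.YangMills.Theorems.Prop7Size19OfRows (size19_of_rows)

set_option maxHeartbeats 400000 in
/-- ★★★ **THE DISPLAYED ROW `hSize19′` OF THE EX KNIT OF RECORD, AS A FAMILY, FROM (46)₁, (46)₂ = (137)–(140) FOR THE NAMED LETTER AND (136)+(140) FOR THE SOLUTION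
PIECE** (module docstring): conclusion = ✓`Prop7StubEXOfChartPiecesTwS7.stubEX_of_chartPiecesTwS7`'s binder `hSize19` VERBATIM; hypotheses = the knit's own letters, rows and
windows + the three displayed rows `h46₁ h46₂ hΔsol` + the constant window `hMdoor`.
[cite: Balaban1985Variational, (ii) p.299, (19) p.281, (46)-(47) p.285, (55) p.286, (136)-(140) pp.298-299, Prop. 6 p.295; Balaban1985BackgroundPropagators, Thm 3.12 p.421] -/
theorem hSize19'_of_rowsL
    (Lift : ∀ (L : ℕ) (i : Idx L), GaugeField (i.1.1.P i.1.2.2) 0 (Matrix.specialUnitaryGroup (Fin 2) ℂ) → Prop)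
    [hFL : ∀ F : T3Family, Fact (0 < (F.L : ℝ))] [hFη : ∀ (F : T3Family) (k : ℕ), Fact (0 < ((F.L : ℝ)⁻¹) ^ k)]
    -- the constants, member-uniform at each `L` (print: «absolute constants depending on d and L only»)
    (B₀ C₄ a₃ α r M : ℕ → ℝ) (hB₀ : ∀ L, 1 < L → 0 < B₀ L) (hC₄ : ∀ L, 1 < L → 0 < C₄ L)
    (hα : ∀ L, 1 < L → 0 < α L) (hr : ∀ L, 1 < L → 0 < r L)
    -- the curved letters `𝔊(U₀)`, `(δ/δA′)V`, `H₁(U₀)`, OPAQUE (the datum `B` is FIXED to `Bsym` on `Λ_k = PBond (P n) 0`)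
    (𝒢f : ∀ (L : ℕ) (i : Idx L) (U₀ : GaugeField (i.1.1.P i.1.2.2) 0 (Matrix.specialUnitaryGroup (Fin 2) ℂ)),
      NegSize (i.1.1.L : ℝ) (((i.1.1.L : ℝ)⁻¹) ^ (i.1.2.2 - i.1.2.1)) (fun _ : Bond 3 (periodsT3 i.1.1 i.1.2.2) => i.1.2.2 - i.1.2.1) 3
          (Matrix (Fin 2) (Fin 2) ℂ) →L[ℂ]
        Space115 (i.1.1.L : ℝ) (((i.1.1.L : ℝ)⁻¹) ^ (i.1.2.2 - i.1.2.1)) (fun _ : Bond 3 (periodsT3 i.1.1 i.1.2.2) => i.1.2.2 - i.1.2.1)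
          (fun _ : Bond 3 (periodsT3 i.1.1 i.1.2.2) × Fin 3 => i.1.2.2 - i.1.2.1) (nabla115 (((i.1.1.L : ℝ)⁻¹) ^ (i.1.2.2 - i.1.2.1)) (bgOfCfg i.1.1 i.1.2.2 U₀)))
    (Wf : ∀ (L : ℕ) (i : Idx L) (U₀ : GaugeField (i.1.1.P i.1.2.2) 0 (Matrix.specialUnitaryGroup (Fin 2) ℂ)),
      Space115 (i.1.1.L : ℝ) (((i.1.1.L : ℝ)⁻¹) ^ (i.1.2.2 - i.1.2.1)) (fun _ : Bond 3 (periodsT3 i.1.1 i.1.2.2) => i.1.2.2 - i.1.2.1)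
          (fun _ : Bond 3 (periodsT3 i.1.1 i.1.2.2) × Fin 3 => i.1.2.2 - i.1.2.1) (nabla115 (((i.1.1.L : ℝ)⁻¹) ^ (i.1.2.2 - i.1.2.1)) (bgOfCfg i.1.1 i.1.2.2 U₀)) →
        NegSize (i.1.1.L : ℝ) (((i.1.1.L : ℝ)⁻¹) ^ (i.1.2.2 - i.1.2.1)) (fun _ : Bond 3 (periodsT3 i.1.1 i.1.2.2) => i.1.2.2 - i.1.2.1) 3 (Matrix (Fin 2) (Fin 2) ℂ))
    (H₁f : ∀ (L : ℕ) (i : Idx L) (U₀ : GaugeField (i.1.1.P i.1.2.2) 0 (Matrix.specialUnitaryGroup (Fin 2) ℂ)),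
      (PBond (i.1.1.P i.1.2.1) 0 → Matrix (Fin 2) (Fin 2) ℂ) →L[ℂ]
        Space115 (i.1.1.L : ℝ) (((i.1.1.L : ℝ)⁻¹) ^ (i.1.2.2 - i.1.2.1)) (fun _ : Bond 3 (periodsT3 i.1.1 i.1.2.2) => i.1.2.2 - i.1.2.1)
          (fun _ : Bond 3 (periodsT3 i.1.1 i.1.2.2) × Fin 3 => i.1.2.2 - i.1.2.1) (nabla115 (((i.1.1.L : ℝ)⁻¹) ^ (i.1.2.2 - i.1.2.1)) (bgOfCfg i.1.1 i.1.2.2 U₀)))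
    -- their displayed bounds (the `SectEDatum` fields at admissible backgrounds)
    (norm_G : ∀ (L : ℕ), 1 < L → ∀ (i : Idx L) (ρ : ℝ) (U₀ : GaugeField (i.1.1.P i.1.2.2) 0 (Matrix.specialUnitaryGroup (Fin 2) ℂ)),
      RegPr i.1.1 i.1.2.1 i.1.2.2 ρ U₀ → ρ ≤ α L → Lift L i U₀ → ∀ f, ‖𝒢f L i U₀ f‖ ≤ B₀ L * ‖f‖)
    (prop4 : ∀ (L : ℕ), 1 < L → ∀ (i : Idx L) (ρ : ℝ) (U₀ : GaugeField (i.1.1.P i.1.2.2) 0 (Matrix.specialUnitaryGroup (Fin 2) ℂ)),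
      RegPr i.1.1 i.1.2.1 i.1.2.2 ρ U₀ → ρ ≤ α L → Lift L i U₀ → QuadAnalytic (Wf L i U₀) (C₄ L) (a₃ L))
    (norm_H₁ : ∀ (L : ℕ), 1 < L → ∀ (i : Idx L) (ρ : ℝ) (U₀ : GaugeField (i.1.1.P i.1.2.2) 0 (Matrix.specialUnitaryGroup (Fin 2) ℂ)),
      RegPr i.1.1 i.1.2.1 i.1.2.2 ρ U₀ → ρ ≤ α L → Lift L i U₀ → ∀ b, ‖H₁f L i U₀ b‖ ≤ B₀ L * ‖b‖)
    -- (45)–(46)-twˢ AT ITS η-ORDER, against the chart of record `Q := QTwS U₀`, (45) in the projected form `IsLandauPrintS` (d): print's letter `H` — `QH = I`, `RD*H = 0` (45), `‖HY‖ ≤ B_H·η·‖Y‖` (46), η = L^{−(K−n)} (DISPLAYED; supplier of record: [Balaban1985BackgroundPropagators]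
    -- Thm 3.12 for `H` (3.126), (3.133) n = 0,1 ⊕ (2.61); T³ statement p607026 `normH₁_row_of_recordObligations` with `Hsel := Hk`; O(η) = pure scaling `H_route = η·H_print`)
    -- CURE (α) (fourth located lettering defect, 2026-08-28): print's (45)–(46) operator `H` is a NAMED top-level letter `Hf` beside `𝒢f Wf H₁f` (supplier instantiates `Hf L i U₀ := H46 … U₀`,
    -- ✓`Prop7SectET3DeltaPiT3`); of its displayed rows only (46)₀ `h46₀` is read by this door
    (Hf : ∀ (L : ℕ) (i : Idx L) (U₀ : GaugeField (i.1.1.P i.1.2.2) 0 (Matrix.specialUnitaryGroup (Fin 2) ℂ)),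
      (PBond (i.1.1.P i.1.2.1) 0 → Matrix (Fin 2) (Fin 2) ℂ) →ₗ[ℂ] (PBond (i.1.1.P i.1.2.2) 0 → Matrix (Fin 2) (Fin 2) ℂ))
    (BH : ℕ → ℝ)
    (h46₀ : ∀ (L : ℕ), 1 < L → ∀ (i : Idx L) (U₀ : GaugeField (i.1.1.P i.1.2.2) 0 (Matrix.specialUnitaryGroup (Fin 2) ℂ)), RegPr i.1.1 i.1.2.1 i.1.2.2 (α L) U₀ → Lift L i U₀ →
      ∀ Y, ‖Hf L i U₀ Y‖ ≤ BH L * eta i.1.1 i.1.2.1 i.1.2.2 * ‖Y‖)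
    -- the radius `e L` of the witness ∕ window theorems and the two L-only numerals (WF) of W3 ∕ W5 ∕ the witness (replace (WΣ))
    (ef : ℕ → ℝ) (hef : ∀ L, 1 < L → 0 < ef L)
    (hWe : ∀ L : ℕ, 1 < L → 10 ^ 9 * (L : ℝ) ^ 2 * ef L ≤ 1) (hWε : ∀ L : ℕ, 1 < L → 10 ^ 12 * (L : ℝ) ^ 3 * α L ≤ 1)
    (ε' : ℕ → ℝ) (hBH0 : ∀ L : ℕ, 1 < L → 0 ≤ BH L)
    (hq47 : ∀ L : ℕ, 1 < L → 9 * (40 * (2 * (3 * (2 * ef L + 2700 * (L : ℝ) * α L))) / ef L ^ 2) * BH L * ε' L < 1)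
    (hR6 : ∀ L : ℕ, 1 < L → 6 * ε' L ≤ ef L)
    (hrε2 : ∀ L : ℕ, 1 < L → 2 * (r L + 2 * B₀ L * α L) ≤ ε' L)
    (hrα : ∀ L : ℕ, 1 < L → 2 * B₀ L * α L ≤ r L) (hr4 : ∀ L : ℕ, 1 < L → 4 * r L ≤ a₃ L) (hr16 : ∀ L : ℕ, 1 < L → 16 * B₀ L * C₄ L * r L ≤ 1)
    -- ROW (46)₁ — the first-order (19)-member of the NAMED letter `Hf` ([Balaban1985Variational] (46) p.285; [Balaban1985BackgroundPropagators] Thm 3.12 (3.133) n = 1; DISPLAYED — ✓p649358 at `H46`)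
    (h46₁ : ∀ (L : ℕ), 1 < L → ∀ (i : Idx L) (U₀ : GaugeField (i.1.1.P i.1.2.2) 0 (Matrix.specialUnitaryGroup (Fin 2) ℂ)), RegPr i.1.1 i.1.2.1 i.1.2.2 (α L) U₀ → Lift L i U₀ →
      ∀ (Y : PBond (i.1.1.P i.1.2.1) 0 → Matrix (Fin 2) (Fin 2) ℂ) (μ ν : Fin (i.1.1.P i.1.2.2).d) (x : Site (i.1.1.P i.1.2.2) 0),
        ‖covGradT 1 (bgUnits i.1.1 i.1.2.2 U₀) (Hf L i U₀ Y) μ ν x‖ ≤ BH L * eta i.1.1 i.1.2.1 i.1.2.2 ^ 2 * ‖Y‖)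
    -- ROW (46)₂ = (137)–(140) — the two second-order (19)-members of `Hf` ([Balaban1985Variational] (137)–(140) pp.298–299; DISPLAYED — ✓p652273∕✓p656472 `hΔH_of_rows` at `H46`)
    (BH₂ : ℕ → ℝ) (hBH₂ : ∀ L : ℕ, 1 < L → 0 ≤ BH₂ L)
    (h46₂ : ∀ (L : ℕ), 1 < L → ∀ (i : Idx L) (U₀ : GaugeField (i.1.1.P i.1.2.2) 0 (Matrix.specialUnitaryGroup (Fin 2) ℂ)), RegPr i.1.1 i.1.2.1 i.1.2.2 (α L) U₀ → Lift L i U₀ →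
      ∀ (Y : PBond (i.1.1.P i.1.2.1) 0 → Matrix (Fin 2) (Fin 2) ℂ),
        (∀ (μ : Fin (i.1.1.P i.1.2.2).d) (x : Site (i.1.1.P i.1.2.2) 0), ‖covCodiffCurlT 1 (bgUnits i.1.1 i.1.2.2 U₀) (Hf L i U₀ Y) μ x‖ ≤ BH₂ L * eta i.1.1 i.1.2.1 i.1.2.2 ^ 3 * ‖Y‖) ∧
        (∀ (ν : Fin (i.1.1.P i.1.2.2).d) (x : Site (i.1.1.P i.1.2.2) 0), ‖covLapFormT 1 (bgUnits i.1.1 i.1.2.2 U₀) (Hf L i U₀ Y) ν x‖ ≤ BH₂ L * eta i.1.1 i.1.2.1 i.1.2.2 ^ 3 * ‖Y‖))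
    -- ROW `hΔsol` — (136) + (140) for the (115)-piece `ιA₁ + ι(H₁B̃)` of THE solution of (111), print's ε₁-form, one `η` below the chart exponent ([Balaban1985Variational] (128)–(136), (140) pp.297–299; DISPLAYED, L)
    (MΔ : ℕ → ℝ) (hMΔ : ∀ L : ℕ, 1 < L → 0 ≤ MΔ L)
    (hΔsol : ∀ (L : ℕ), 1 < L → ∀ (i : Idx L) (ε₁ : ℝ) (V : GaugeField (i.1.1.P i.1.2.1) 0 (Matrix.specialUnitaryGroup (Fin 2) ℂ))
      (U₀ : GaugeField (i.1.1.P i.1.2.2) 0 (Matrix.specialUnitaryGroup (Fin 2) ℂ)), 0 < ε₁ → PlaqSmall ε₁ V →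
      RegPr i.1.1 i.1.2.1 i.1.2.2 ((L : ℝ) ^ 3 * (3 * (L : ℝ)) * ε₁) U₀ → CloseAvg i.1.1 i.1.2.1 i.1.2.2 i.2.2.le ((L : ℝ) ^ 3 * ε₁) V U₀ → Lift L i U₀ → (L : ℝ) ^ 3 * (3 * (L : ℝ)) * ε₁ ≤ α L →
      ∀ A₁ : Space115 (i.1.1.L : ℝ) (((i.1.1.L : ℝ)⁻¹) ^ (i.1.2.2 - i.1.2.1)) (fun _ : Bond 3 (periodsT3 i.1.1 i.1.2.2) => i.1.2.2 - i.1.2.1)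
          (fun _ : Bond 3 (periodsT3 i.1.1 i.1.2.2) × Fin 3 => i.1.2.2 - i.1.2.1) (nabla115 (((i.1.1.L : ℝ)⁻¹) ^ (i.1.2.2 - i.1.2.1)) (bgOfCfg i.1.1 i.1.2.2 U₀)),
        ‖A₁‖ < r L →
        A₁ + 𝒢f L i U₀ (Jcur (bgOfCfg i.1.1 i.1.2.2 U₀)) + 𝒢f L i U₀ (Wf L i U₀ (A₁ + H₁f L i U₀ (fun c : PBond (i.1.1.P i.1.2.1) 0 =>
          (-Complex.I) • mlog (((V c : Matrix.specialUnitaryGroup (Fin 2) ℂ) : Matrix (Fin 2) (Fin 2) ℂ)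
            * star ((descendTo i.1.1 ℰp i.1.2.1 i.1.2.2 i.2.2.le U₀ c : Matrix.specialUnitaryGroup (Fin 2) ℂ) : Matrix (Fin 2) (Fin 2) ℂ))))) = 0 →
        (∀ (μ : Fin (i.1.1.P i.1.2.2).d) (x : Site (i.1.1.P i.1.2.2) 0),
            ‖covCodiffCurlT 1 (bgUnits i.1.1 i.1.2.2 U₀) ((fun b : PBond (i.1.1.P i.1.2.2) 0 => JetSup.equiv _ _ _ A₁ (bondEquiv i.1.1 i.1.2.2 b))
            + (fun b : PBond (i.1.1.P i.1.2.2) 0 => JetSup.equiv _ _ _ (H₁f L i U₀ (fun c : PBond (i.1.1.P i.1.2.1) 0 =>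
          (-Complex.I) • mlog (((V c : Matrix.specialUnitaryGroup (Fin 2) ℂ) : Matrix (Fin 2) (Fin 2) ℂ)
            * star ((descendTo i.1.1 ℰp i.1.2.1 i.1.2.2 i.2.2.le U₀ c : Matrix.specialUnitaryGroup (Fin 2) ℂ) : Matrix (Fin 2) (Fin 2) ℂ)))) (bondEquiv i.1.1 i.1.2.2 b))) μ x‖ ≤ MΔ L * ((L : ℝ) ^ 3 * (3 * (L : ℝ)) * ε₁) * eta i.1.1 i.1.2.1 i.1.2.2 ^ 2) ∧
          (∀ (ν : Fin (i.1.1.P i.1.2.2).d) (x : Site (i.1.1.P i.1.2.2) 0),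
            ‖covLapFormT 1 (bgUnits i.1.1 i.1.2.2 U₀) ((fun b : PBond (i.1.1.P i.1.2.2) 0 => JetSup.equiv _ _ _ A₁ (bondEquiv i.1.1 i.1.2.2 b))
            + (fun b : PBond (i.1.1.P i.1.2.2) 0 => JetSup.equiv _ _ _ (H₁f L i U₀ (fun c : PBond (i.1.1.P i.1.2.1) 0 =>
          (-Complex.I) • mlog (((V c : Matrix.specialUnitaryGroup (Fin 2) ℂ) : Matrix (Fin 2) (Fin 2) ℂ)
            * star ((descendTo i.1.1 ℰp i.1.2.1 i.1.2.2 i.2.2.le U₀ c : Matrix.specialUnitaryGroup (Fin 2) ℂ) : Matrix (Fin 2) (Fin 2) ℂ)))) (bondEquiv i.1.1 i.1.2.2 b))) ν x‖ ≤ MΔ L * ((L : ℝ) ^ 3 * (3 * (L : ℝ)) * ε₁) * eta i.1.1 i.1.2.1 i.1.2.2 ^ 2))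
    -- the constant window: the junction's explicit member constant, read at `ρ ≤ α`, is below the display's `M L`
    (hMdoor : ∀ L : ℕ, 1 < L → 11 * B₀ L + 4 * BH L * (40 * (2 * (3 * (2 * ef L + 2700 * (L : ℝ) * α L))) / ef L ^ 2) * (11 * B₀ L) ^ 2 * α L + MΔ L + 100 * BH₂ L * (40 * (2 * (3 * (2 * ef L + 2700 * (L : ℝ) * α L))) / ef L ^ 2) * B₀ L ^ 2 * α L ≤ M L) :
    ∀ (L : ℕ), 1 < L → ∀ (i : Idx L) (ε₁ : ℝ) (V : GaugeField (i.1.1.P i.1.2.1) 0 (Matrix.specialUnitaryGroup (Fin 2) ℂ))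
      (U₀ : GaugeField (i.1.1.P i.1.2.2) 0 (Matrix.specialUnitaryGroup (Fin 2) ℂ)), 0 < ε₁ → PlaqSmall ε₁ V →
      RegPr i.1.1 i.1.2.1 i.1.2.2 ((L : ℝ) ^ 3 * (3 * (L : ℝ)) * ε₁) U₀ → CloseAvg i.1.1 i.1.2.1 i.1.2.2 i.2.2.le ((L : ℝ) ^ 3 * ε₁) V U₀ → Lift L i U₀ → (L : ℝ) ^ 3 * (3 * (L : ℝ)) * ε₁ ≤ α L →
      ∀ A₁ : Space115 (i.1.1.L : ℝ) (((i.1.1.L : ℝ)⁻¹) ^ (i.1.2.2 - i.1.2.1)) (fun _ : Bond 3 (periodsT3 i.1.1 i.1.2.2) => i.1.2.2 - i.1.2.1)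
          (fun _ : Bond 3 (periodsT3 i.1.1 i.1.2.2) × Fin 3 => i.1.2.2 - i.1.2.1) (nabla115 (((i.1.1.L : ℝ)⁻¹) ^ (i.1.2.2 - i.1.2.1)) (bgOfCfg i.1.1 i.1.2.2 U₀)),
        ‖A₁‖ < r L →
        A₁ + 𝒢f L i U₀ (Jcur (bgOfCfg i.1.1 i.1.2.2 U₀)) + 𝒢f L i U₀ (Wf L i U₀ (A₁ + H₁f L i U₀ (fun c : PBond (i.1.1.P i.1.2.1) 0 =>
          (-Complex.I) • mlog (((V c : Matrix.specialUnitaryGroup (Fin 2) ℂ) : Matrix (Fin 2) (Fin 2) ℂ)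
            * star ((descendTo i.1.1 ℰp i.1.2.1 i.1.2.2 i.2.2.le U₀ c : Matrix.specialUnitaryGroup (Fin 2) ℂ) : Matrix (Fin 2) (Fin 2) ℂ))))) = 0 →
        nMax19 i.1.1 i.1.2.1 i.1.2.2 U₀ (fun b : PBond (i.1.1.P i.1.2.2) 0 => (-Complex.I) • ((((eta i.1.1 i.1.2.1 i.1.2.2 : ℝ) : ℂ) * Complex.I) • ((fun b : PBond (i.1.1.P i.1.2.2) 0 => JetSup.equiv _ _ _ A₁ (bondEquiv i.1.1 i.1.2.2 b))
              + (fun b : PBond (i.1.1.P i.1.2.2) 0 => JetSup.equiv _ _ _ (H₁f L i U₀ (fun c : PBond (i.1.1.P i.1.2.1) 0 =>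
          (-Complex.I) • mlog (((V c : Matrix.specialUnitaryGroup (Fin 2) ℂ) : Matrix (Fin 2) (Fin 2) ℂ)
            * star ((descendTo i.1.1 ℰp i.1.2.1 i.1.2.2 i.2.2.le U₀ c : Matrix.specialUnitaryGroup (Fin 2) ℂ) : Matrix (Fin 2) (Fin 2) ℂ)))) (bondEquiv i.1.1 i.1.2.2 b)))
            - Hf L i U₀ (Dfix (CmapTwS i.1.1 i.1.2.1 i.1.2.2 i.2.2.le U₀) (Hf L i U₀) (40 * (2 * (3 * (2 * ef L + 2700 * (i.1.1.L : ℝ) * α L))) / (ef L * eta i.1.1 i.1.2.1 i.1.2.2) ^ 2)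
              ((((eta i.1.1 i.1.2.1 i.1.2.2 : ℝ) : ℂ) * Complex.I) • ((fun b : PBond (i.1.1.P i.1.2.2) 0 => JetSup.equiv _ _ _ A₁ (bondEquiv i.1.1 i.1.2.2 b))
              + (fun b : PBond (i.1.1.P i.1.2.2) 0 => JetSup.equiv _ _ _ (H₁f L i U₀ (fun c : PBond (i.1.1.P i.1.2.1) 0 =>
          (-Complex.I) • mlog (((V c : Matrix.specialUnitaryGroup (Fin 2) ℂ) : Matrix (Fin 2) (Fin 2) ℂ)
            * star ((descendTo i.1.1 ℰp i.1.2.1 i.1.2.2 i.2.2.le U₀ c : Matrix.specialUnitaryGroup (Fin 2) ℂ) : Matrix (Fin 2) (Fin 2) ℂ)))) (bondEquiv i.1.1 i.1.2.2 b)))))) b)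
          ≤ M L * ((L : ℝ) ^ 3 * (3 * (L : ℝ)) * ε₁) := by
  intro L hL i ε₁ V U₀ hε₁ hV hreg hclose hLift hαe A₁ hA₁ hsol
  have hFL' : (i.1.1.L : ℝ) = (L : ℝ) := by exact_mod_cast i.2.1
  have hL0 : (0 : ℝ) < (L : ℝ) := by exact_mod_cast (show 0 < L by omega)
  have hL1 : (1 : ℝ) ≤ (L : ℝ) := by exact_mod_cast hL.le
  have hL3 : (3 : ℝ) ≤ (L : ℝ) := by rw [← hFL']; exact three_le_memberL i
  obtain ⟨s3, -⟩ := windows_of_W hL3 (hα L hL).le (hef L hL).le (hWe L hL) (hWε L hL)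
  have hWe' : 10 ^ 9 * (i.1.1.L : ℝ) ^ 2 * ef L ≤ 1 := by rw [hFL']; exact hWe L hL
  have hWε' : 10 ^ 12 * (i.1.1.L : ℝ) ^ 3 * α L ≤ 1 := by rw [hFL']; exact hWε L hL
  have hα0 : 0 < α L := hα L hL
  have he0 : 0 < ef L := hef L hL
  have hB0 : 0 < B₀ L := hB₀ L hL
  have hη : 0 < eta i.1.1 i.1.2.1 i.1.2.2 := T3SectALandauChart.eta_pos i.1.1 i.1.2.1 i.1.2.2
  have hregα : RegPr i.1.1 i.1.2.1 i.1.2.2 (α L) U₀ := regPr_mono i.1.1 hαe hreg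
  have hreg' : RegPr i.1.1 i.1.2.1 i.1.2.2 ((i.1.1.L : ℝ) ^ 3 * (3 * (i.1.1.L : ℝ)) * ε₁) U₀ := by rw [hFL']; exact hreg
  have hHB := h46₀ L hL i U₀ hregα hLift
  have hwin : (i.1.1.L : ℝ) ^ 3 * ε₁ ≤ 1 / 2 := by rw [hFL']; exact (windows_of_admissible hL1 hε₁.le hαe s3).1
  -- the chart (47) as a quadratic-analytic map (✓`inputs_CmapTwS`) and the contraction windows of (55)
  have hin := inputs_CmapTwS i.1.1 i.2.2.le hα0 he0 hWe' hWε' U₀ hregα hHB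
  have hC := hin.quadAnalytic
  have hq' : 9 * (40 * (2 * (3 * (2 * ef L + 2700 * (i.1.1.L : ℝ) * α L))) / (ef L * eta i.1.1 i.1.2.1 i.1.2.2) ^ 2)
      * (BH L * eta i.1.1 i.1.2.1 i.1.2.2) * (eta i.1.1 i.1.2.1 i.1.2.2 * ε' L) < 1 := by
    have hcalc : 9 * (40 * (2 * (3 * (2 * ef L + 2700 * (i.1.1.L : ℝ) * α L))) / (ef L * eta i.1.1 i.1.2.1 i.1.2.2) ^ 2)
        * (BH L * eta i.1.1 i.1.2.1 i.1.2.2) * (eta i.1.1 i.1.2.1 i.1.2.2 * ε' L)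
        = 9 * (40 * (2 * (3 * (2 * ef L + 2700 * (i.1.1.L : ℝ) * α L))) / ef L ^ 2) * BH L * ε' L := by
      field_simp
    rw [hcalc, hFL']; exact hq47 L hL
  have hR' : 3 * (eta i.1.1 i.1.2.1 i.1.2.2 * ε' L) ≤ 2 * (ef L * eta i.1.1 i.1.2.1 i.1.2.2 / 4) := by nlinarith [hR6 L hL]
  -- the size windows: `η·5B₀ρ ≤ η·ε′` (from `ρ ≤ α`, `hrα`, `hrε2`), Prop. 6's `h1 h2 h3`
  have hρα : (i.1.1.L : ℝ) ^ 3 * (3 * (i.1.1.L : ℝ)) * ε₁ ≤ α L := by rw [hFL']; exact hαe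
  have hρ0 : 0 ≤ (i.1.1.L : ℝ) ^ 3 * (3 * (i.1.1.L : ℝ)) * ε₁ := by rw [hFL']; positivity
  have hεb : eta i.1.1 i.1.2.1 i.1.2.2 * (3 * B₀ L * ((i.1.1.L : ℝ) ^ 3 * (3 * (i.1.1.L : ℝ)) * ε₁)
      + B₀ L * (2 * ((3 : ℝ) * i.1.1.L) * ((i.1.1.L : ℝ) ^ 3 * ε₁))) ≤ eta i.1.1 i.1.2.1 i.1.2.2 * ε' L := by
    have h5 : 3 * B₀ L * ((i.1.1.L : ℝ) ^ 3 * (3 * (i.1.1.L : ℝ)) * ε₁) + B₀ L * (2 * ((3 : ℝ) * i.1.1.L) * ((i.1.1.L : ℝ) ^ 3 * ε₁))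
        = 5 * B₀ L * ((i.1.1.L : ℝ) ^ 3 * (3 * (i.1.1.L : ℝ)) * ε₁) := by ring
    rw [h5]
    refine mul_le_mul_of_nonneg_left ?_ hη.le
    nlinarith [hrα L hL, hrε2 L hL, mul_le_mul_of_nonneg_left hρα hB0.le, hr L hL]
  have h1 : 2 * B₀ L * (i.1.1.L : ℝ) ^ 3 * (3 * (i.1.1.L : ℝ)) * ε₁ ≤ r L := by
    nlinarith [hrα L hL, mul_le_mul_of_nonneg_left hρα hB0.le]
  -- the junction at this member (✓p655784)
  have hmem := size19_of_rows i.1.1 i.1.2.1 i.1.2.2 i.2.2.le U₀ V (𝒢f L i U₀) (Wf L i U₀) (H₁f L i U₀) (Hf L i U₀)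
    (CmapTwS i.1.1 i.1.2.1 i.1.2.2 i.2.2.le U₀) hB0 (hC₄ L hL) (hBH0 L hL) (hBH₂ L hL)
    (by positivity : (0 : ℝ) ≤ 40 * (2 * (3 * (2 * ef L + 2700 * (i.1.1.L : ℝ) * α L))) / (ef L * eta i.1.1 i.1.2.1 i.1.2.2) ^ 2) hε₁ (hMΔ L hL)
    (norm_G L hL i _ U₀ hreg hαe hLift) (prop4 L hL i _ U₀ hreg hαe hLift) (norm_H₁ L hL i _ U₀ hreg hαe hLift) hHB (h46₁ L hL i U₀ hregα hLift) (h46₂ L hL i U₀ hregα hLift)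
    hC hq' hR' hεb h1 (hr4 L hL) (hr16 L hL) hreg' (by rw [hFL']; exact hclose) hwin A₁ hA₁ hsol
    ⟨fun μ x => ((hΔsol L hL i ε₁ V U₀ hε₁ hV hreg hclose hLift hαe A₁ hA₁ hsol).1 μ x).trans_eq (by rw [hFL']),
     fun ν x => ((hΔsol L hL i ε₁ V U₀ hε₁ hV hreg hclose hLift hαe A₁ hA₁ hsol).2 ν x).trans_eq (by rw [hFL'])⟩
  -- the member constant, read at `ρ ≤ α` with `C₂ˢ·η² = K_L`, is below `M L`
  refine hmem.trans ?_
  rw [hFL']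
  have hK : 40 * (2 * (3 * (2 * ef L + 2700 * (L : ℝ) * α L))) / (ef L * eta i.1.1 i.1.2.1 i.1.2.2) ^ 2 * eta i.1.1 i.1.2.1 i.1.2.2 ^ 2 = (40 * (2 * (3 * (2 * ef L + 2700 * (L : ℝ) * α L))) / ef L ^ 2) := by
    field_simp
  have hρL0 : 0 ≤ ((L : ℝ) ^ 3 * (3 * (L : ℝ)) * ε₁) := by positivity
  have hKL0 : 0 ≤ (40 * (2 * (3 * (2 * ef L + 2700 * (L : ℝ) * α L))) / ef L ^ 2) := by positivity
  have hcoef : 11 * B₀ L + 4 * BH L * (40 * (2 * (3 * (2 * ef L + 2700 * (L : ℝ) * α L))) / (ef L * eta i.1.1 i.1.2.1 i.1.2.2) ^ 2) * eta i.1.1 i.1.2.1 i.1.2.2 ^ 2 * (11 * B₀ L) ^ 2 * ((L : ℝ) ^ 3 * (3 * (L : ℝ)) * ε₁)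
      + MΔ L + 100 * BH₂ L * (40 * (2 * (3 * (2 * ef L + 2700 * (L : ℝ) * α L))) / (ef L * eta i.1.1 i.1.2.1 i.1.2.2) ^ 2) * B₀ L ^ 2 * eta i.1.1 i.1.2.1 i.1.2.2 ^ 2 * ((L : ℝ) ^ 3 * (3 * (L : ℝ)) * ε₁) ≤ M L := by
    have e1 : 4 * BH L * (40 * (2 * (3 * (2 * ef L + 2700 * (L : ℝ) * α L))) / (ef L * eta i.1.1 i.1.2.1 i.1.2.2) ^ 2) * eta i.1.1 i.1.2.1 i.1.2.2 ^ 2 * (11 * B₀ L) ^ 2 * ((L : ℝ) ^ 3 * (3 * (L : ℝ)) * ε₁)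
        = 4 * BH L * (40 * (2 * (3 * (2 * ef L + 2700 * (L : ℝ) * α L))) / ef L ^ 2) * (11 * B₀ L) ^ 2 * ((L : ℝ) ^ 3 * (3 * (L : ℝ)) * ε₁) := by rw [← hK]; ring
    have e2 : 100 * BH₂ L * (40 * (2 * (3 * (2 * ef L + 2700 * (L : ℝ) * α L))) / (ef L * eta i.1.1 i.1.2.1 i.1.2.2) ^ 2) * B₀ L ^ 2 * eta i.1.1 i.1.2.1 i.1.2.2 ^ 2 * ((L : ℝ) ^ 3 * (3 * (L : ℝ)) * ε₁)
        = 100 * BH₂ L * (40 * (2 * (3 * (2 * ef L + 2700 * (L : ℝ) * α L))) / ef L ^ 2) * B₀ L ^ 2 * ((L : ℝ) ^ 3 * (3 * (L : ℝ)) * ε₁) := by rw [← hK]; ring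
    rw [e1, e2]
    have m1 : 4 * BH L * (40 * (2 * (3 * (2 * ef L + 2700 * (L : ℝ) * α L))) / ef L ^ 2) * (11 * B₀ L) ^ 2 * ((L : ℝ) ^ 3 * (3 * (L : ℝ)) * ε₁) ≤ 4 * BH L * (40 * (2 * (3 * (2 * ef L + 2700 * (L : ℝ) * α L))) / ef L ^ 2) * (11 * B₀ L) ^ 2 * α L :=
      mul_le_mul_of_nonneg_left hαe (by have := hBH0 L hL; positivity)
    have m2 : 100 * BH₂ L * (40 * (2 * (3 * (2 * ef L + 2700 * (L : ℝ) * α L))) / ef L ^ 2) * B₀ L ^ 2 * ((L : ℝ) ^ 3 * (3 * (L : ℝ)) * ε₁) ≤ 100 * BH₂ L * (40 * (2 * (3 * (2 * ef L + 2700 * (L : ℝ) * α L))) / ef L ^ 2) * B₀ L ^ 2 * α L :=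
      mul_le_mul_of_nonneg_left hαe (by have := hBH₂ L hL; positivity)
    linarith [hMdoor L hL]
  exact mul_le_mul_of_nonneg_right hcoef hρL0

end Summit.QuantumFields.YangMills.Theorems.Prop7Size19OfRowsFamilyLLift

end
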